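import Literature.Topology.FourManifolds.NonSeparatingSpheresReduction
import Literature.Topology.FourManifolds.SphereSimplyConnected
import Literature.Topology.FourManifolds.DehnSurgeryTubularNbhdProofs
import Literature.Topology.FourManifolds.SurgeredMappingTorus
import Mathlib.Topology.Homotopy.Lifting
import HarnessLib

/-!
# Budney–Gabai Thm. 3.13: lifting an `n`-sphere of `S¹ × Sⁿ` to the cyclic cover `ℝ × Sⁿ`

Companion to `Literature/Topology/FourManifolds/NonSeparatingSpheres.lean` (the named fact
`Literature.Topology.FourManifolds.BudneyGabai2019_thm_3_13`: `Diff(S¹ × Sⁿ)` acts transitively on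
the non-separating smoothly embedded `n`-spheres of `S¹ × Sⁿ`; R. Budney, D. Gabai, *Knotted
3-balls in `S⁴`*, arXiv:1912.09029, Thm. 3.13) and to `NonSeparatingSpheresReduction.lean`
(the vacuous case `n = 0`, reduction to the standard target).  **Everything in this file is
proved; no definition and no named fact is introduced.**

Both the classical argument for `n = 2` and the first step of the printed proof for `n ≥ 3`
("complementary to a non-separating sphere there is an embedding `S¹ → S¹ × Sⁿ` that intersects
the sphere precisely once and transversely [...] we can isotope our embedding to be equal to
`S¹ × {*}`", ibid. p. 22: the dual circle is homotopic to `S¹ × {*}` because its degree over `S¹`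
is `±1`, which is read off in the infinite cyclic cover) begin by lifting the sphere to the
covering `ℝ × Sⁿ → S¹ × Sⁿ`, `(t, p) ↦ (e^{it}, p)`.  This file supplies that lift, for Mathlib's
`Circle.exp : ℝ → Circle` and the standard unit sphere `Sⁿ ⊂ ℝⁿ⁺¹`:

* `CircleExpLift.contMDiffAt_of_continuousAt` — **a continuous lift of a smooth circle-valued map
  is smooth**: if `y ↦ exp (g y)` is `C^∞` at `x` (any real manifold, any model) and `g` is
  continuous at `x`, then `g` is `C^∞` at `x` (near `x`, `g` is an angle function of the circle,
  smooth at `exp (g x)`, composed with `exp ∘ g`, plus a constant in `2πℤ`);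
* `CircleExpLift.exists_continuousMap_comp_eq` — every continuous map from a simply connected,
  locally path connected space to `S¹` lifts through `exp` (Mathlib's lifting criterion
  `IsCoveringMap.existsUnique_continuousMap_lifts` for the covering `Circle.isCoveringMap_exp`;
  Hatcher, *Algebraic Topology*, Prop. 1.33);
* `CircleExpLift.exists_contMDiff_comp_eq_sphere` — hence every `C^∞` map `Sⁿ → S¹`, `n ≥ 2`,
  is `exp ∘ g` for a `C^∞` function `g : Sⁿ → ℝ` (`π₁(Sⁿ) = 1`, the tree's
  `simplyConnectedSpace_euclideanSphere`, Hatcher Prop. 1.14);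
* `BudneyGabai2019_thm_3_13.exists_lift_smooth` — **every smooth map `e : Sⁿ → S¹ × Sⁿ`, `n ≥ 2`,
  lifts** to a smooth `el : Sⁿ → ℝ × Sⁿ` with `(exp × id) ∘ el = e`;
* `BudneyGabai2019_thm_3_13.exists_lift_isSmoothEmbedding` — **a smoothly embedded `n`-sphere of
  `S¹ × Sⁿ`, `n ≥ 2`, lifts to a smoothly embedded `n`-sphere of `ℝ × Sⁿ`** (the lift is
  injective because `e` is, and immersive because `d(exp × id) ∘ del = de` is injective; an
  injective immersion of the compact `Sⁿ` is an embedding, the tree's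
  `isSmoothEmbedding_of_injective_of_injective_mfderiv`), whose **translates under the deck
  transformations `(t, p) ↦ (t + 2πm, p)`, `m ≠ 0`, are pairwise disjoint from it**
  (`BudneyGabai2019_thm_3_13.eq_of_lift_eq_deck`, `…disjoint_range_lift_deck`): two points of
  the lift differing by a deck transformation have the same image under the injective `e`.

The covering map itself is written `Prod.map Circle.exp id` throughout (it is smooth,
`BudneyGabai2019_thm_3_13.contMDiff_prodMap_circleExp`, and `2π`-periodic in `t`,
`…prodMap_circleExp_deck`).

## References

* R. Budney, D. Gabai, *Knotted 3-balls in `S⁴`*, arXiv:1912.09029 (v2), §3, Thm. 3.13 and its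
  proof (p. 22). [BudneyGabai2019]
* A. Hatcher, *Algebraic Topology*, CUP (2002), §1.1 Prop. 1.14, §1.3 Props. 1.30, 1.33.
  [HatcherAT2002]
-/

noncomputable section

open scoped Manifold ContDiff Topology Real
open Set Function Metric

namespace Literature.Topology.FourManifolds

/-! ### Continuous lifts through `exp : ℝ → S¹` -/

namespace CircleExpLift

section Smooth

variable {E H : Type*} [NormedAddCommGroup E] [NormedSpace ℝ E] [TopologicalSpace H]
  {I : ModelWithCorners ℝ E H} {M : Type*} [TopologicalSpace M] [ChartedSpace H M]

/-- **An angle function smooth at a prescribed point**: for every `z₀ ∈ S¹` there is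
`A : S¹ → ℝ` with `exp ∘ A = id` which is `C^∞` at `z₀` (the principal argument if `z₀ ≠ -1`,
the argument slit at `1` otherwise: the tree's `contMDiffAt_arg_circle`,
`contMDiffAt_arg_neg_circle`, `SurgeredMappingTorus.lean`). [folklore] -/
theorem exists_angle_contMDiffAt (z₀ : Circle) :
    ∃ A : Circle → ℝ, ContMDiffAt (𝓡 1) 𝓘(ℝ, ℝ) ∞ A z₀ ∧ ∀ z, Circle.exp (A z) = z := by
  rcases mem_slitPlane_or_neg_mem_slitPlane z₀ with h | h
  · exact ⟨fun w ↦ Complex.arg (w : ℂ), contMDiffAt_arg_circle h, Circle.exp_arg⟩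
  · exact ⟨fun w ↦ Complex.arg (-(w : ℂ)) + π, contMDiffAt_arg_neg_circle h,
      circleExp_arg_neg_add_pi⟩

/-- A real function with values in `ℤ` that is continuous at a point is constant near that
point. [folklore] -/
private theorem eventually_eq_of_continuousAt_of_forall_exists_int {α : Type*} [TopologicalSpace α]
    {f : α → ℝ} {x₀ : α} (hf : ContinuousAt f x₀) (hZ : ∀ x, ∃ k : ℤ, f x = k) :
    ∀ᶠ x in 𝓝 x₀, f x = f x₀ := by
  have h := (Metric.tendsto_nhds.1 hf) 1 one_pos
  filter_upwards [h] with x hx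
  obtain ⟨k, hk⟩ := hZ x
  obtain ⟨k₀, hk₀⟩ := hZ x₀
  rw [hk, hk₀] at hx ⊢
  rw [Int.dist_cast_real, Int.dist_eq] at hx
  have hx' : |k - k₀| < 1 := by exact_mod_cast hx
  rw [eq_of_sub_eq_zero (Int.abs_lt_one_iff.1 hx')]

/-- **A continuous lift of a smooth circle-valued map is smooth.**  If `y ↦ e^{i g(y)}` is `C^∞`
at `x` and the real function `g` is continuous at `x`, then `g` is `C^∞` at `x`: with an angle
function `A` of the circle smooth at `e^{i g(x)}` (`exists_angle_contMDiffAt`), the difference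
`g - A ∘ exp ∘ g` takes values in `2πℤ` and is continuous at `x`, hence constant near `x`, so
that `g = A ∘ (exp ∘ g) + const` near `x`.  (Local sections of the covering `exp : ℝ → S¹` are
smooth: Hatcher, *Algebraic Topology*, §1.3, with the smooth structure of `S¹`.) [folklore] -/
theorem contMDiffAt_of_continuousAt {g : M → ℝ} {x : M} (hg : ContinuousAt g x)
    (hf : ContMDiffAt I (𝓡 1) ∞ (fun y ↦ Circle.exp (g y)) x) :
    ContMDiffAt I 𝓘(ℝ, ℝ) ∞ g x := by
  obtain ⟨A, hA, hAexp⟩ := exists_angle_contMDiffAt (Circle.exp (g x))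
  have hπ : (2 * π : ℝ) ≠ 0 := by positivity
  have hk : ∀ y, ∃ k : ℤ, (g y - A (Circle.exp (g y))) / (2 * π) = k := fun y ↦ by
    obtain ⟨m, hm⟩ := Circle.exp_eq_exp.1 (hAexp (Circle.exp (g y))).symm
    refine ⟨m, ?_⟩
    rw [show g y - A (Circle.exp (g y)) = m * (2 * π) by linarith, mul_div_assoc, div_self hπ,
      mul_one]
  have hcomp : ContMDiffAt I 𝓘(ℝ, ℝ) ∞ (fun y ↦ A (Circle.exp (g y))) x := hA.comp x hf
  have hcont : ContinuousAt (fun y ↦ (g y - A (Circle.exp (g y))) / (2 * π)) x :=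
    (hg.sub hcomp.continuousAt).div_const _
  have hev : g =ᶠ[𝓝 x] fun y ↦ A (Circle.exp (g y)) + (g x - A (Circle.exp (g x))) := by
    filter_upwards [eventually_eq_of_continuousAt_of_forall_exists_int hcont hk] with y hy
    rw [div_eq_div_iff hπ hπ] at hy
    have := mul_right_cancel₀ hπ hy
    linarith
  exact (hcomp.add contMDiffAt_const).congr_of_eventuallyEq hev

/-- **A continuous lift of a smooth circle-valued map is smooth** (global form): if `exp ∘ g`
is `C^∞` and `g` is continuous then `g` is `C^∞`. [folklore] -/
theorem contMDiff_of_continuous {g : M → ℝ} (hg : Continuous g)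
    (hf : ContMDiff I (𝓡 1) ∞ (fun y ↦ Circle.exp (g y))) : ContMDiff I 𝓘(ℝ, ℝ) ∞ g :=
  fun x ↦ contMDiffAt_of_continuousAt hg.continuousAt (hf x)

end Smooth

section Exists

/-- **Maps from simply connected spaces to the circle lift to `ℝ`**: a continuous map `f` from
a simply connected, locally path connected space to `S¹` is `exp ∘ g` for a continuous real
function `g` (Mathlib's lifting criterion `IsCoveringMap.existsUnique_continuousMap_lifts` for
the covering map `exp : ℝ → S¹`, `Circle.isCoveringMap_exp`; Hatcher, *Algebraic Topology*
(2002), Prop. 1.33). [cite: HatcherAT2002, Prop. 1.33] -/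
theorem exists_continuousMap_comp_eq {X : Type*} [TopologicalSpace X] [SimplyConnectedSpace X]
    [LocallyPathConnectedSpace X] (f : C(X, Circle)) :
    ∃ g : C(X, ℝ), ∀ x, Circle.exp (g x) = f x := by
  rcases isEmpty_or_nonempty X with hX | ⟨⟨x₀⟩⟩
  · exact ⟨0, fun x ↦ (IsEmpty.false x).elim⟩
  obtain ⟨g, ⟨-, hg⟩, -⟩ := Circle.isCoveringMap_exp.existsUnique_continuousMap_lifts f x₀
    (Complex.arg (f x₀ : ℂ)) (Circle.exp_arg _)
  exact ⟨g, fun x ↦ congr_fun hg x⟩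

/-- **Every smooth map `Sⁿ → S¹`, `n ≥ 2`, has a smooth real lift**: it is `exp ∘ g` for a `C^∞`
function `g : Sⁿ → ℝ` (`Sⁿ` is simply connected for `n ≥ 2`, the tree's
`simplyConnectedSpace_euclideanSphere` — Hatcher Prop. 1.14 — and locally path connected as a
manifold; the continuous lift of `exists_continuousMap_comp_eq` is smooth by
`contMDiff_of_continuous`). [cite: HatcherAT2002, Props. 1.14, 1.33] -/
theorem exists_contMDiff_comp_eq_sphere {n : ℕ} (hn : 2 ≤ n)
    {f : sphere (0 : EuclideanSpace ℝ (Fin (n + 1))) 1 → Circle}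
    (hf : ContMDiff (𝓡 n) (𝓡 1) ∞ f) :
    ∃ g : sphere (0 : EuclideanSpace ℝ (Fin (n + 1))) 1 → ℝ,
      ContMDiff (𝓡 n) 𝓘(ℝ, ℝ) ∞ g ∧ ∀ x, Circle.exp (g x) = f x := by
  haveI := simplyConnectedSpace_euclideanSphere hn
  haveI : LocallyPathConnectedSpace (sphere (0 : EuclideanSpace ℝ (Fin (n + 1))) 1) :=
    ChartedSpace.locallyPathConnectedSpace (EuclideanSpace ℝ (Fin n)) _
  obtain ⟨g, hg⟩ := exists_continuousMap_comp_eq ⟨f, hf.continuous⟩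
  have hfg : (fun x ↦ Circle.exp (g x)) = f := funext hg
  exact ⟨g, contMDiff_of_continuous g.continuous (hfg ▸ hf), hg⟩

end Exists

end CircleExpLift

/-! ### The cyclic cover `ℝ × Sⁿ → S¹ × Sⁿ` and lifts of spheres -/

namespace BudneyGabai2019_thm_3_13

variable {n : ℕ}

/-- The covering map `(t, p) ↦ (e^{it}, p) : ℝ × Sⁿ → S¹ × Sⁿ` is smooth. [folklore] -/
theorem contMDiff_prodMap_circleExp :
    ContMDiff (𝓘(ℝ, ℝ).prod (𝓡 n)) ((𝓡 1).prod (𝓡 n)) ∞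
      (Prod.map Circle.exp id : ℝ × sphere (0 : EuclideanSpace ℝ (Fin (n + 1))) 1 →
        Circle × sphere (0 : EuclideanSpace ℝ (Fin (n + 1))) 1) :=
  contMDiff_circleExp.prodMap contMDiff_id

/-- The covering map `(t, p) ↦ (e^{it}, p)` is invariant under the deck transformations
`(t, p) ↦ (t + 2πm, p)`, `m ∈ ℤ`. [folklore] -/
theorem prodMap_circleExp_deck (m : ℤ) (q : ℝ × sphere (0 : EuclideanSpace ℝ (Fin (n + 1))) 1) :
    Prod.map Circle.exp id ((q.1 + m * (2 * π), q.2) :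
        ℝ × sphere (0 : EuclideanSpace ℝ (Fin (n + 1))) 1) =
      (Prod.map Circle.exp id q : Circle × sphere (0 : EuclideanSpace ℝ (Fin (n + 1))) 1) := by
  obtain ⟨t, p⟩ := q
  simp only [Prod.map_apply, id_eq, Prod.mk.injEq, and_true]
  exact Circle.exp_eq_exp.2 ⟨m, rfl⟩

/-- Two points of `ℝ × Sⁿ` have the same image in `S¹ × Sⁿ` iff they differ by a deck
transformation `(t, p) ↦ (t + 2πm, p)`, `m ∈ ℤ`. [folklore] -/
theorem prodMap_circleExp_eq_iff (q q' : ℝ × sphere (0 : EuclideanSpace ℝ (Fin (n + 1))) 1) :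
    (Prod.map Circle.exp id q : Circle × sphere (0 : EuclideanSpace ℝ (Fin (n + 1))) 1) =
        Prod.map Circle.exp id q' ↔
      ∃ m : ℤ, q = (q'.1 + m * (2 * π), q'.2) := by
  obtain ⟨t, p⟩ := q
  obtain ⟨t', p'⟩ := q'
  simp only [Prod.map_apply, id_eq, Prod.mk.injEq]
  constructor
  · rintro ⟨ht, rfl⟩
    obtain ⟨m, hm⟩ := Circle.exp_eq_exp.1 ht
    exact ⟨m, hm, rfl⟩
  · rintro ⟨m, hm, rfl⟩
    exact ⟨Circle.exp_eq_exp.2 ⟨m, hm⟩, rfl⟩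

/-- **Smooth maps `Sⁿ → S¹ × Sⁿ`, `n ≥ 2`, lift to the cyclic cover**: a `C^∞` map
`e : Sⁿ → S¹ × Sⁿ` is `(exp × id) ∘ el` for a `C^∞` map `el : Sⁿ → ℝ × Sⁿ` (lift the first
coordinate by `CircleExpLift.exists_contMDiff_comp_eq_sphere`, keep the second).
[cite: HatcherAT2002, Prop. 1.33] -/
theorem exists_lift_smooth (hn : 2 ≤ n)
    {e : sphere (0 : EuclideanSpace ℝ (Fin (n + 1))) 1 →
      Circle × sphere (0 : EuclideanSpace ℝ (Fin (n + 1))) 1}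
    (he : ContMDiff (𝓡 n) ((𝓡 1).prod (𝓡 n)) ∞ e) :
    ∃ el : sphere (0 : EuclideanSpace ℝ (Fin (n + 1))) 1 →
        ℝ × sphere (0 : EuclideanSpace ℝ (Fin (n + 1))) 1,
      ContMDiff (𝓡 n) (𝓘(ℝ, ℝ).prod (𝓡 n)) ∞ el ∧ Prod.map Circle.exp id ∘ el = e := by
  obtain ⟨g, hg, hge⟩ :=
    CircleExpLift.exists_contMDiff_comp_eq_sphere hn (contMDiff_fst.comp he)
  refine ⟨fun x ↦ (g x, (e x).2), hg.prodMk (contMDiff_snd.comp he),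
    funext fun x ↦ Prod.ext ?_ rfl⟩
  simpa using hge x

/-- **Points of a lift with the same projection are equal, and so are the deck parameters**:
if `(exp × id) ∘ el = e` with `e` injective and `el y` is the translate of `el x` by the deck
transformation of parameter `m ∈ ℤ`, then `m = 0` and `x = y`. [folklore] -/
theorem eq_of_lift_eq_deck
    {e : sphere (0 : EuclideanSpace ℝ (Fin (n + 1))) 1 →
      Circle × sphere (0 : EuclideanSpace ℝ (Fin (n + 1))) 1} (hinj : Injective e)
    {el : sphere (0 : EuclideanSpace ℝ (Fin (n + 1))) 1 →
      ℝ × sphere (0 : EuclideanSpace ℝ (Fin (n + 1))) 1}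
    (hlift : Prod.map Circle.exp id ∘ el = e)
    {x y : sphere (0 : EuclideanSpace ℝ (Fin (n + 1))) 1} {m : ℤ}
    (h : el y = ((el x).1 + m * (2 * π), (el x).2)) : m = 0 ∧ x = y := by
  have hxy : e y = e x := by
    rw [← hlift, comp_apply, comp_apply, h, prodMap_circleExp_deck]
  have hyx : y = x := hinj hxy
  subst hyx
  refine ⟨?_, rfl⟩
  have h1 := congrArg Prod.fst h
  simp only at h1
  have hπ : (0 : ℝ) < 2 * π := by positivity
  have hm : (m : ℝ) * (2 * π) = 0 := by linarith
  exact_mod_cast (mul_eq_zero.1 hm).resolve_right hπ.ne'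

/-- **The nonzero deck translates of a lifted sphere are disjoint from it**: for a lift `el` of
an injective `e : Sⁿ → S¹ × Sⁿ` and `m ≠ 0`, the translate of `el(Sⁿ)` by `(t, p) ↦ (t + 2πm, p)`
does not meet `el(Sⁿ)` (the lifts of an embedded sphere to the infinite cyclic cover are
pairwise disjoint copies). [folklore] -/
theorem disjoint_range_lift_deck
    {e : sphere (0 : EuclideanSpace ℝ (Fin (n + 1))) 1 →
      Circle × sphere (0 : EuclideanSpace ℝ (Fin (n + 1))) 1} (hinj : Injective e)
    {el : sphere (0 : EuclideanSpace ℝ (Fin (n + 1))) 1 →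
      ℝ × sphere (0 : EuclideanSpace ℝ (Fin (n + 1))) 1}
    (hlift : Prod.map Circle.exp id ∘ el = e) {m : ℤ} (hm : m ≠ 0) :
    Disjoint (range el)
      ((fun q : ℝ × sphere (0 : EuclideanSpace ℝ (Fin (n + 1))) 1 ↦
        ((q.1 + m * (2 * π), q.2) : ℝ × sphere (0 : EuclideanSpace ℝ (Fin (n + 1))) 1)) ''
          range el) := by
  refine disjoint_left.2 ?_
  rintro _ ⟨y, rfl⟩ ⟨_, ⟨x, rfl⟩, hq⟩
  exact hm (eq_of_lift_eq_deck hinj hlift hq.symm).1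

/-- **A smoothly embedded `n`-sphere of `S¹ × Sⁿ`, `n ≥ 2`, lifts to a smoothly embedded
`n`-sphere of the cyclic cover `ℝ × Sⁿ`.**  For a `C^∞` embedding `e : Sⁿ → S¹ × Sⁿ` there is a
`C^∞` embedding `el : Sⁿ → ℝ × Sⁿ` with `(exp × id) ∘ el = e`: the smooth lift of
`exists_lift_smooth` is injective because `e` is, and its differential is injective because
`d(exp × id) ∘ del = de` is (the differential of an immersion is injective, the tree's
`mfderiv_injective_of_isImmersion`); an injective immersion of the compact `Sⁿ` into the
Hausdorff `ℝ × Sⁿ` is an embedding (`isSmoothEmbedding_of_injective_of_injective_mfderiv`,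
Hirsch, *Differential Topology*, Ch. 1 §3, Thm. 3.1).  This is the first step of the proof of
Thm. 3.13 (the degree count for the dual circle, `n ≥ 3`; the classical argument, `n = 2`).
[cite: BudneyGabai2019, proof of Thm. 3.13; HatcherAT2002, Prop. 1.33] -/
theorem exists_lift_isSmoothEmbedding (hn : 2 ≤ n)
    {e : sphere (0 : EuclideanSpace ℝ (Fin (n + 1))) 1 →
      Circle × sphere (0 : EuclideanSpace ℝ (Fin (n + 1))) 1}
    (he : Manifold.IsSmoothEmbedding (𝓡 n) ((𝓡 1).prod (𝓡 n)) ∞ e) :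
    ∃ el : sphere (0 : EuclideanSpace ℝ (Fin (n + 1))) 1 →
        ℝ × sphere (0 : EuclideanSpace ℝ (Fin (n + 1))) 1,
      Manifold.IsSmoothEmbedding (𝓡 n) (𝓘(ℝ, ℝ).prod (𝓡 n)) ∞ el ∧
        Prod.map Circle.exp id ∘ el = e := by
  obtain ⟨el, hel, hlift⟩ := exists_lift_smooth hn he.contMDiff
  have hinj : Injective e := he.isEmbedding.injective
  refine ⟨el, isSmoothEmbedding_of_injective_of_injective_mfderiv hel (by simp) ?_ fun x ↦ ?_,
    hlift⟩
  · -- injectivity of the lift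
    intro x y hxy
    exact hinj (by rw [← hlift, comp_apply, comp_apply, hxy])
  · -- injectivity of the differential of the lift
    have hde : Injective (mfderiv (𝓡 n) ((𝓡 1).prod (𝓡 n)) e x) :=
      mfderiv_injective_of_isImmersion he.isImmersion (by simp) x
    rw [← hlift, mfderiv_comp x (contMDiff_prodMap_circleExp.mdifferentiableAt (by simp))
      (hel.mdifferentiableAt (by simp))] at hde
    have key : Injective
        (⇑(mfderiv (𝓘(ℝ, ℝ).prod (𝓡 n)) ((𝓡 1).prod (𝓡 n))
            (Prod.map Circle.exp id : ℝ × sphere (0 : EuclideanSpace ℝ (Fin (n + 1))) 1 →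
              Circle × sphere (0 : EuclideanSpace ℝ (Fin (n + 1))) 1) (el x)) ∘
          ⇑(mfderiv (𝓡 n) (𝓘(ℝ, ℝ).prod (𝓡 n)) el x)) := hde
    exact key.of_comp

end BudneyGabai2019_thm_3_13

end Literature.Topology.FourManifolds

end
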